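import Mathlib.Combinatorics.SetFamily.HarrisKleitman
import Mathlib.Algebra.Order.BigOperators.Group.Finset
import Mathlib.Algebra.BigOperators.Ring.Finset
import Mathlib.Tactic.Linarith

/-!
# `NoHeavyLowerTail` (crux stmt-CriticalPhenomena-4575), lane prim-ineq-gen-4 (gen 18): the fibre lemma (RAB_k) of the
# spectator certificate for the threshold slots `Θ_k`, FOR EVERY `k` — the section inequality and the induction

Support file (`--supports stmt-CriticalPhenomena-4575`; memo `run/shared/lean/prim/prim-ineq-gen-4/PROOFS-RAB-ALL-K-g18.md`).
Pure finite combinatorics, no definitions, no `sorry`, standard axioms.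

CONTEXT.  Gen 17 proved three-partition positivity for the threshold slot `Θ₂` (all `n`) from a fibrewise certificate whose one
non-atomic fibre inequality was (RAB₂), and conjectured (RAB_k) for general `k` (memo g17 §0(E)).  This file proves (RAB_k) for ALL
`k`, conditionally on ONE half-cube lemma for intersecting families (hypothesis `hC`; Katona-circle proof in the memo §2).

THE STATEMENT, in the down-set form used here (complementation `u ↦ s \ u` inside the ground set `s` turns the memo's up-sets into
down-sets, which are honest `IsLowerSet`s of `Finset α`).  For lower sets `D, E` of finsets contained in `s`, `y = #s`, and `k` with
`2k ≤ y + 2`, writing "cross pair" for `z ∈ D` with `s \ z ∈ E`: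
  `Ψ_k(D,E) := #{v ∈ D ∩ E : #v + k ≤ y} − #{v ∈ D ∩ E : y < #v + k} − Σ_{cross z} ([k ≤ #z] + [#z + k ≤ y] − 1) ≥ 0`
(`rab_of_halfCube`, integer-sum form; `rab_counting_of_halfCube`, counting form).  For `k = 0` this is Kleitman–Harris
(`#{cross} ≤ #(D ∩ E)`), for `k = 2` it is gen-17's `card_window_add_singletons_le` up to complementation.
PROOF.  `psi_section`: `Ψ_k^{s+a}(D,E) ≥ Ψ_k^{s}(D_a,E_a) + Ψ_{k-1}^{s}(D_{¬a},E_{¬a})` (member / non-member subfamilies; pointwise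
comparison of the four cross weights); induction on `s` down to the boundary `#s + 2 = 2k` (`boundary_of_halfCube`, from `hC`).
-/

namespace Summit.CriticalPhenomena.PercolationContinuityZ3.Theorems.ThresholdRAB

open Finset

variable {α : Type*} [DecidableEq α]

/-! ### Splitting a sum over a set family at a point -/

/-- `Σ_{v ∈ 𝒜} f v = Σ_{v ∈ 𝒜_a} f (insert a v) + Σ_{v ∈ 𝒜_{¬a}} f v` (member / non-member subfamilies at `a`). [folklore] -/
theorem sum_eq_memberSubfamily_add_nonMemberSubfamily (𝒜 : Finset (Finset α)) (a : α) (f : Finset α → ℤ) :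
    ∑ v ∈ 𝒜, f v = ∑ v ∈ 𝒜.memberSubfamily a, f (insert a v) + ∑ v ∈ 𝒜.nonMemberSubfamily a, f v := by
  rw [← sum_filter_add_sum_filter_not 𝒜 (fun v => a ∈ v) f]
  congr 1
  · rw [← image_insert_memberSubfamily, sum_image]
    intro x hx y hy hxy
    rw [mem_coe, mem_memberSubfamily] at hx hy
    rw [← erase_insert hx.2, hxy, erase_insert hy.2]

/-- A sum over a subfamily `ℬ ⊆ 𝒜` as a sum over `𝒜` with an indicator. [folklore] -/
theorem sum_subfamily_eq_sum_ite {𝒜 ℬ : Finset (Finset α)} (h : ℬ ⊆ 𝒜) (f : Finset α → ℤ) :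
    ∑ v ∈ ℬ, f v = ∑ v ∈ 𝒜, if v ∈ ℬ then f v else 0 := by
  rw [← sum_filter, filter_mem_eq_inter, inter_eq_right.2 h]

/-! ### The cross weight `λ_{k,y}(a) = [k ≤ a] + [a + k ≤ y] − 1` : four pointwise facts -/

/-- `λ_{k-1,y-1}(a) ≥ 0` when `2k ≤ y + 2` and `a + 1 ≤ y`. [this work] -/
theorem lam_pred_nonneg (k y a : ℕ) (hy : 2 * k ≤ y + 2) (ha : a + 1 ≤ y) :
    (0 : ℤ) ≤ (if k - 1 ≤ a then 1 else 0) + (if a + (k - 1) ≤ y - 1 then 1 else 0) - 1 := by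
  split_ifs <;> omega

/-- `λ_{k-1,y-1}(a) ≥ λ_{k,y}(a+1)` when `a + 1 ≤ y`. [this work] -/
theorem lam_succ_le_lam_pred (k y a : ℕ) (ha : a + 1 ≤ y) :
    ((if k ≤ a + 1 then 1 else 0) + (if a + 1 + k ≤ y then 1 else 0) - 1 : ℤ)
      ≤ (if k - 1 ≤ a then 1 else 0) + (if a + (k - 1) ≤ y - 1 then 1 else 0) - 1 := by
  split_ifs <;> omega

/-- `λ_{k-1,y-1}(a) ≥ λ_{k,y}(a)` when `a + 1 ≤ y`. [this work] -/
theorem lam_le_lam_pred (k y a : ℕ) (ha : a + 1 ≤ y) :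
    ((if k ≤ a then 1 else 0) + (if a + k ≤ y then 1 else 0) - 1 : ℤ)
      ≤ (if k - 1 ≤ a then 1 else 0) + (if a + (k - 1) ≤ y - 1 then 1 else 0) - 1 := by
  split_ifs <;> omega

/-- `λ_{k-1,y-1}(a) + λ_{k,y-1}(a) = λ_{k,y}(a+1) + λ_{k,y}(a)` when `a + 1 ≤ y`. [this work] -/
theorem lam_pred_add_lam (k y a : ℕ) (ha : a + 1 ≤ y) :
    ((if k - 1 ≤ a then 1 else 0) + (if a + (k - 1) ≤ y - 1 then 1 else 0) - 1 : ℤ)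
      + ((if k ≤ a then 1 else 0) + (if a + k ≤ y - 1 then 1 else 0) - 1)
      = ((if k ≤ a + 1 then 1 else 0) + (if a + 1 + k ≤ y then 1 else 0) - 1)
        + ((if k ≤ a then 1 else 0) + (if a + k ≤ y then 1 else 0) - 1) := by
  split_ifs <;> omega

/-- The pointwise comparison behind the section inequality: with indicators `dm ≤ dn`, `em ≤ en` (here: propositions with
`dm → True`, `em → en`), `dn·en·λ_{k-1,y-1}(a) + dm·em·λ_{k,y-1}(a) ≥ dm·en·λ_{k,y}(a+1) + dn·em·λ_{k,y}(a)` (the `dn`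
indicator is the ambient one and omitted). [this work] -/
theorem cross_pointwise (k y a : ℕ) (hy : 2 * k ≤ y + 2) (ha : a + 1 ≤ y) (dm em en : Prop) [Decidable dm]
    [Decidable em] [Decidable en] (hmn : em → en) :
    (if dm ∧ en then ((if k ≤ a + 1 then 1 else 0) + (if a + 1 + k ≤ y then 1 else 0) - 1 : ℤ) else 0)
      + (if em then ((if k ≤ a then 1 else 0) + (if a + k ≤ y then 1 else 0) - 1 : ℤ) else 0)
      ≤ (if en then ((if k - 1 ≤ a then 1 else 0) + (if a + (k - 1) ≤ y - 1 then 1 else 0) - 1 : ℤ) else 0)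
        + (if dm ∧ em then ((if k ≤ a then 1 else 0) + (if a + k ≤ y - 1 then 1 else 0) - 1 : ℤ) else 0) := by
  have h1 := lam_pred_nonneg k y a hy ha
  have h2 := lam_succ_le_lam_pred k y a ha
  have h3 := lam_le_lam_pred k y a ha
  have h4 := lam_pred_add_lam k y a ha
  by_cases hen : en
  · by_cases hem : em
    · by_cases hdm : dm
      · simp only [hdm, hen, hem, and_self, if_true]
        linarith
      · simp only [hdm, hen, hem, false_and, if_false, if_true]
        linarith
    · by_cases hdm : dm
      · simp only [hdm, hen, hem, and_true, and_false, if_true, if_false]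
        linarith
      · simp only [hdm, hen, hem, false_and, if_false, if_true]
        linarith
  · have hem : ¬ em := fun h => hen (hmn h)
    simp only [hen, hem, and_false, if_false]
    linarith

/-! ### The section inequality -/

section SectionIneq

variable {s : Finset α} {a : α} {D E : Finset (Finset α)}

/-- Members of a subfamily at `a` of a family supported in `insert a s` are supported in `s` (non-member part). [folklore] -/
theorem subset_of_mem_nonMemberSubfamily (hD : ∀ t ∈ D, t ⊆ insert a s) {t : Finset α}
    (ht : t ∈ D.nonMemberSubfamily a) : t ⊆ s := by
  rw [mem_nonMemberSubfamily] at ht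
  exact (subset_insert_iff_of_notMem ht.2).1 (hD _ ht.1)

/-- Members of a subfamily at `a` of a family supported in `insert a s` are supported in `s` (member part). [folklore] -/
theorem subset_of_mem_memberSubfamily (hD : ∀ t ∈ D, t ⊆ insert a s) {t : Finset α}
    (ht : t ∈ D.memberSubfamily a) : t ⊆ s := by
  rw [mem_memberSubfamily] at ht
  exact (subset_insert_iff_of_notMem ht.2).1 ((subset_insert _ _).trans <| hD _ ht.1)

/-- Diagonal part: `Σ_{v ∈ D∩E} w_k^{s+a}(#v) = Σ_{v ∈ D_a ∩ E_a} w_k^{s}(#v) + Σ_{v ∈ D_{¬a} ∩ E_{¬a}} w_{k-1}^{s}(#v)`,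
`w_k^t(c) = [c + k ≤ #t] − [#t < c + k]`. [this work] -/
theorem diag_section (has : a ∉ s) (hD : ∀ t ∈ D, t ⊆ insert a s) (k : ℕ) :
    ∑ v ∈ D ∩ E, (if #v + k ≤ #(insert a s) then (1 : ℤ) else -1)
      = ∑ v ∈ D.memberSubfamily a ∩ E.memberSubfamily a, (if #v + k ≤ #s then (1 : ℤ) else -1)
        + ∑ v ∈ D.nonMemberSubfamily a ∩ E.nonMemberSubfamily a, (if #v + (k - 1) ≤ #s then (1 : ℤ) else -1) := by
  rw [sum_eq_memberSubfamily_add_nonMemberSubfamily (D ∩ E) a, memberSubfamily_inter, nonMemberSubfamily_inter,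
    card_insert_of_notMem has]
  congr 1
  · refine sum_congr rfl fun v hv => ?_
    rw [mem_inter, mem_memberSubfamily] at hv
    rw [card_insert_of_notMem hv.1.2]
    have : #v + 1 + k ≤ #s + 1 ↔ #v + k ≤ #s := by omega
    simp only [this]
  · refine sum_congr rfl fun v hv => ?_
    have hvs : v ⊆ s := subset_of_mem_nonMemberSubfamily hD (mem_inter.1 hv).1
    have hcs : #v ≤ #s := card_le_card hvs
    have : #v + k ≤ #s + 1 ↔ #v + (k - 1) ≤ #s := by omega
    simp only [this]

/-- Cross part, rewritten over the sections: `Σ_{z ∈ D, (s+a)\z ∈ E} g(#z) = Σ_{z ∈ D_a, s\z ∈ E_{¬a}} g(#z+1) +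
Σ_{z ∈ D_{¬a}, s\z ∈ E_a} g(#z)`, written with indicators. [this work] -/
theorem cross_section (has : a ∉ s) (g : ℕ → ℤ) :
    ∑ z ∈ D with insert a s \ z ∈ E, g #z
      = ∑ z ∈ D.memberSubfamily a, (if s \ z ∈ E.nonMemberSubfamily a then g (#z + 1) else 0)
        + ∑ z ∈ D.nonMemberSubfamily a, (if s \ z ∈ E.memberSubfamily a then g #z else 0) := by
  rw [sum_filter, sum_eq_memberSubfamily_add_nonMemberSubfamily D a]
  congr 1
  · refine sum_congr rfl fun z hz => ?_
    rw [mem_memberSubfamily] at hz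
    have hz2 : a ∉ z := hz.2
    have h1 : insert a s \ insert a z = s \ z := by
      rw [insert_sdiff_insert, sdiff_insert_of_notMem has]
    have h2 : (s \ z ∈ E) ↔ (s \ z ∈ E.nonMemberSubfamily a) := by
      rw [mem_nonMemberSubfamily]
      exact ⟨fun h => ⟨h, fun h' => has (mem_sdiff.1 h').1⟩, fun h => h.1⟩
    rw [h1, card_insert_of_notMem hz2]
    simp only [h2]
  · refine sum_congr rfl fun z hz => ?_
    rw [mem_nonMemberSubfamily] at hz
    have h1 : insert a s \ z = insert a (s \ z) := insert_sdiff_of_notMem s hz.2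
    have h2 : (insert a (s \ z) ∈ E) ↔ (s \ z ∈ E.memberSubfamily a) := by
      rw [mem_memberSubfamily]
      exact ⟨fun h => ⟨h, fun h' => has (mem_sdiff.1 h').1⟩, fun h => h.1⟩
    rw [h1]
    simp only [h2]

/-- **Section inequality** (memo Lemma A, down-set form).  For lower sets `D, E` supported in `insert a s` (`a ∉ s`) and
`2k ≤ #s + 3`:  `Ψ_k^{insert a s}(D,E) ≥ Ψ_k^{s}(D_a,E_a) + Ψ_{k-1}^{s}(D_{¬a},E_{¬a})`. [this work] -/
theorem psi_section (has : a ∉ s) (hD : IsLowerSet (D : Set (Finset α))) (hE : IsLowerSet (E : Set (Finset α)))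
    (hDs : ∀ t ∈ D, t ⊆ insert a s) (k : ℕ) (hk : 2 * k ≤ #s + 3) :
    (∑ v ∈ D.memberSubfamily a ∩ E.memberSubfamily a, (if #v + k ≤ #s then (1 : ℤ) else -1))
        - (∑ z ∈ D.memberSubfamily a with s \ z ∈ E.memberSubfamily a,
            ((if k ≤ #z then 1 else 0) + (if #z + k ≤ #s then 1 else 0) - 1 : ℤ))
      + ((∑ v ∈ D.nonMemberSubfamily a ∩ E.nonMemberSubfamily a, (if #v + (k - 1) ≤ #s then (1 : ℤ) else -1))
        - (∑ z ∈ D.nonMemberSubfamily a with s \ z ∈ E.nonMemberSubfamily a,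
            ((if k - 1 ≤ #z then 1 else 0) + (if #z + (k - 1) ≤ #s then 1 else 0) - 1 : ℤ)))
      ≤ (∑ v ∈ D ∩ E, (if #v + k ≤ #(insert a s) then (1 : ℤ) else -1))
        - ∑ z ∈ D with insert a s \ z ∈ E,
            ((if k ≤ #z then 1 else 0) + (if #z + k ≤ #(insert a s) then 1 else 0) - 1 : ℤ) := by
  have hc := cross_section (D := D) (E := E) has
    (fun c : ℕ => ((if k ≤ c then 1 else 0) + (if c + k ≤ #(insert a s) then 1 else 0) - 1 : ℤ))
  rw [diag_section has hDs k, hc, card_insert_of_notMem has]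
  have hsub : D.memberSubfamily a ⊆ D.nonMemberSubfamily a := hD.memberSubfamily_subset_nonMemberSubfamily
  have hsubE : E.memberSubfamily a ⊆ E.nonMemberSubfamily a := hE.memberSubfamily_subset_nonMemberSubfamily
  rw [sum_subfamily_eq_sum_ite hsub, sum_filter, sum_filter, sum_subfamily_eq_sum_ite hsub]
  -- everything is now a sum over `D.nonMemberSubfamily a`; compare pointwise
  have key : ∀ z ∈ D.nonMemberSubfamily a,
      (if z ∈ D.memberSubfamily a then
          (if s \ z ∈ E.nonMemberSubfamily a then
            ((if k ≤ #z + 1 then 1 else 0) + (if #z + 1 + k ≤ #s + 1 then 1 else 0) - 1 : ℤ) else 0) else 0)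
        + (if s \ z ∈ E.memberSubfamily a then
            ((if k ≤ #z then 1 else 0) + (if #z + k ≤ #s + 1 then 1 else 0) - 1 : ℤ) else 0)
      ≤ (if s \ z ∈ E.nonMemberSubfamily a then
            ((if k - 1 ≤ #z then 1 else 0) + (if #z + (k - 1) ≤ #s then 1 else 0) - 1 : ℤ) else 0)
        + (if z ∈ D.memberSubfamily a then
            (if s \ z ∈ E.memberSubfamily a then
              ((if k ≤ #z then 1 else 0) + (if #z + k ≤ #s then 1 else 0) - 1 : ℤ) else 0) else 0) := by
    intro z hz
    have hzs : z ⊆ s := subset_of_mem_nonMemberSubfamily hDs hz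
    have hcz : #z + 1 ≤ #s + 1 := by have := card_le_card hzs; omega
    have h := cross_pointwise k (#s + 1) #z (by omega) hcz (z ∈ D.memberSubfamily a)
      (s \ z ∈ E.memberSubfamily a) (s \ z ∈ E.nonMemberSubfamily a) (fun h => hsubE h)
    have e1 : #z + (k - 1) ≤ #s + 1 - 1 ↔ #z + (k - 1) ≤ #s := by omega
    have e2 : #z + k ≤ #s + 1 - 1 ↔ #z + k ≤ #s := by omega
    simp only [e1, e2, ite_and] at h
    convert h using 2
  have hle := sum_le_sum key
  rw [sum_add_distrib, sum_add_distrib] at hle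
  linarith

end SectionIneq

/-! ### The boundary case `#s + 2 = 2k` from the half-cube lemma -/

section Boundary

variable {s : Finset α} {D E : Finset (Finset α)}

/-- For a lower set `C ⊆ 𝒫(s)`, the members `z` whose complement `s \ z` is NOT in `C` form a lower set… [this work] -/
theorem isLowerSet_filter_sdiff_not_mem {C : Finset (Finset α)} (hC : IsLowerSet (C : Set (Finset α))) :
    IsLowerSet ((C.filter fun z => s \ z ∉ C : Finset (Finset α)) : Set (Finset α)) := by
  intro z w hwz hz
  rw [mem_coe, mem_filter] at hz ⊢
  refine ⟨hC hwz hz.1, fun hw => hz.2 (hC ?_ hw)⟩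
  exact sdiff_subset_sdiff (le_refl s) hwz

/-- … no two members of which cover `s`. [this work] -/
theorem union_ne_of_filter_sdiff_not_mem {C : Finset (Finset α)} (hC : IsLowerSet (C : Set (Finset α)))
    {z w : Finset α} (hz : z ∈ C.filter fun z => s \ z ∉ C) (hw : w ∈ C.filter fun z => s \ z ∉ C) :
    z ∪ w ≠ s := by
  intro hzw
  rw [mem_filter] at hz hw
  refine hz.2 (hC ?_ hw.1)
  intro x hx
  rw [mem_sdiff] at hx
  have : x ∈ z ∪ w := hzw ▸ hx.1
  rcases mem_union.1 this with h | h
  · exact absurd h hx.2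
  · exact h

/-- Complementation inside `s` exchanges the members of `C` of size `< m` with complement in `C` and those of size `> m`
with complement in `C` (`#s = 2m`). [this work] -/
theorem card_filter_lt_sdiff_mem_eq {C : Finset (Finset α)} (hCs : ∀ t ∈ C, t ⊆ s) {m : ℕ} (hs : #s = 2 * m) :
    #(C.filter fun z => s \ z ∈ C ∧ #z < m) = #(C.filter fun z => s \ z ∈ C ∧ m < #z) := by
  refine card_bij (fun z _ => s \ z) (fun z hz => ?_) (fun z hz w hw h => ?_) (fun w hw => ?_)
  · rw [mem_filter] at hz ⊢
    have hzs : z ⊆ s := hCs _ hz.1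
    refine ⟨hz.2.1, ?_, ?_⟩
    · rw [Finset.sdiff_sdiff_eq_self hzs]; exact hz.1
    · rw [card_sdiff_of_subset hzs]; omega
  · rw [mem_filter] at hz hw
    rw [← Finset.sdiff_sdiff_eq_self (hCs _ hz.1), h, Finset.sdiff_sdiff_eq_self (hCs _ hw.1)]
  · rw [mem_filter] at hw
    have hws : w ⊆ s := hCs _ hw.1
    refine ⟨s \ w, ?_, Finset.sdiff_sdiff_eq_self hws⟩
    rw [mem_filter]
    refine ⟨hw.2.1, ?_, ?_⟩
    · rw [Finset.sdiff_sdiff_eq_self hws]; exact hw.1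
    · have := card_le_card hws
      rw [card_sdiff_of_subset hws]; omega

/-- **Boundary case** (memo Lemma D, down-set form): if the half-cube lemma holds on `s` (`#s = 2m`), then for lower sets
`D, E ⊆ 𝒫(s)` and `k = m + 1`:  `#{v ∈ D∩E : #v ≥ m} ≤ #{v ∈ D∩E : #v < m} + #{z ∈ D : s \ z ∈ E, #z = m}`. [this work] -/
theorem boundary_of_halfCube {m : ℕ} (hs : #s = 2 * m)
    (hC : ∀ F : Finset (Finset α), IsLowerSet (F : Set (Finset α)) → (∀ t ∈ F, t ⊆ s) →
      (∀ z ∈ F, ∀ w ∈ F, z ∪ w ≠ s) → #(F.filter fun z => m ≤ #z) ≤ #(F.filter fun z => #z < m))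
    (hD : IsLowerSet (D : Set (Finset α))) (hE : IsLowerSet (E : Set (Finset α))) (hDs : ∀ t ∈ D, t ⊆ s) :
    #((D ∩ E).filter fun v => m ≤ #v)
      ≤ #((D ∩ E).filter fun v => #v < m) + #((D.filter fun z => s \ z ∈ E).filter fun z => #z = m) := by
  set C := D ∩ E with hCdef
  have hCl : IsLowerSet (C : Set (Finset α)) := by
    rw [hCdef, coe_inter]; exact hD.inter hE
  have hCs : ∀ t ∈ C, t ⊆ s := fun t ht => hDs t (mem_inter.1 ht).1
  set F := C.filter fun z => s \ z ∉ C with hFdef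
  have hF := hC F (isLowerSet_filter_sdiff_not_mem hCl) (fun t ht => hCs t (mem_filter.1 ht).1)
    (fun z hz w hw => union_ne_of_filter_sdiff_not_mem hCl hz hw)
  -- split `C` at each level range by whether the complement lies in `C`
  have hsplit : ∀ p : Finset α → Prop, ∀ [DecidablePred p],
      #(C.filter p) = #(F.filter p) + #(C.filter fun z => s \ z ∈ C ∧ p z) := by
    intro p _
    rw [hFdef, filter_filter, ← card_union_of_disjoint]
    · congr 1; ext z; simp only [mem_filter, mem_union]; tauto
    · rw [disjoint_left]; intro z hz hz'; rw [mem_filter] at hz hz'; exact hz.2.1 hz'.2.1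
  have hge := hsplit (fun v => m ≤ #v)
  have hlt := hsplit (fun v => #v < m)
  -- the complemented part: sizes `≥ m` = size `m` + sizes `> m`, and sizes `> m` ↔ sizes `< m`
  have hsym := card_filter_lt_sdiff_mem_eq hCs hs
  have hge2 : #(C.filter fun z => s \ z ∈ C ∧ m ≤ #z)
      = #(C.filter fun z => s \ z ∈ C ∧ #z = m) + #(C.filter fun z => s \ z ∈ C ∧ m < #z) := by
    rw [← card_union_of_disjoint]
    · congr 1; ext z; simp only [mem_filter, mem_union]; constructor
      · rintro ⟨h1, h2, h3⟩
        rcases Nat.eq_or_lt_of_le h3 with h | h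
        · exact Or.inl ⟨h1, h2, h.symm⟩
        · exact Or.inr ⟨h1, h2, h⟩
      · rintro (⟨h1, h2, h3⟩ | ⟨h1, h2, h3⟩)
        · exact ⟨h1, h2, h3.ge⟩
        · exact ⟨h1, h2, h3.le⟩
    · rw [disjoint_left]; intro z hz hz'; rw [mem_filter] at hz hz'; omega
  -- the middle complemented sets are cross pairs of `(D,E)` of size `m`
  have hmid : #(C.filter fun z => s \ z ∈ C ∧ #z = m) ≤ #((D.filter fun z => s \ z ∈ E).filter fun z => #z = m) := by
    apply card_le_card
    intro z hz
    rw [mem_filter] at hz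
    rw [mem_filter, mem_filter]
    exact ⟨⟨(mem_inter.1 hz.1).1, (mem_inter.1 hz.2.1).2⟩, hz.2.2⟩
  omega

end Boundary

/-! ### (RAB_k) for all `k`, by induction on the ground set -/

/-- **(RAB_k) for every `k`**, integer-sum form, conditional on the half-cube lemma `hC` (memo Lemma C: a lower set
`F ⊆ 𝒫(t)`, `#t = 2m`, with no two members covering `t` has at most as many members of size `≥ m` as of size `< m`).
For lower sets `D, E ⊆ 𝒫(s)` and `2k ≤ #s + 2`:
`Σ_{v ∈ D∩E} ([#v + k ≤ #s] − [#s < #v + k]) − Σ_{z ∈ D, s\z ∈ E} ([k ≤ #z] + [#z + k ≤ #s] − 1) ≥ 0`. [this work] -/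
theorem rab_of_halfCube
    (hC : ∀ (t : Finset α) (m : ℕ) (F : Finset (Finset α)), #t = 2 * m → IsLowerSet (F : Set (Finset α)) →
      (∀ u ∈ F, u ⊆ t) → (∀ z ∈ F, ∀ w ∈ F, z ∪ w ≠ t) → #(F.filter fun z => m ≤ #z) ≤ #(F.filter fun z => #z < m))
    (s : Finset α) :
    ∀ (k : ℕ) (D E : Finset (Finset α)), IsLowerSet (D : Set (Finset α)) → IsLowerSet (E : Set (Finset α)) →
      (∀ t ∈ D, t ⊆ s) → (∀ t ∈ E, t ⊆ s) → 2 * k ≤ #s + 2 →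
      0 ≤ (∑ v ∈ D ∩ E, (if #v + k ≤ #s then (1 : ℤ) else -1))
            - ∑ z ∈ D with s \ z ∈ E, ((if k ≤ #z then 1 else 0) + (if #z + k ≤ #s then 1 else 0) - 1 : ℤ) := by
  induction s using Finset.induction with
  | empty =>
    intro k D E hD hE hDs hEs hk
    have hD' : D ⊆ {∅} := fun t ht => mem_singleton.2 (subset_empty.1 (hDs t ht))
    have hE' : E ⊆ {∅} := fun t ht => mem_singleton.2 (subset_empty.1 (hEs t ht))
    have hk01 : k = 0 ∨ k = 1 := by rw [card_empty] at hk; omega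
    rcases subset_singleton_iff.1 hD' with rfl | rfl <;> rcases subset_singleton_iff.1 hE' with rfl | rfl <;>
      rcases hk01 with rfl | rfl <;> simp
  | insert a s has ih =>
    intro k D E hD hE hDs hEs hk
    rw [card_insert_of_notMem has] at hk
    by_cases hb : 2 * k = #s + 3
    · -- boundary: `#(insert a s) = 2k - 2`, `k = m + 1`, `#(insert a s) = 2m`
      obtain ⟨m, rfl⟩ : ∃ m, k = m + 1 := ⟨k - 1, by omega⟩
      have hsm : #(insert a s) = 2 * m := by rw [card_insert_of_notMem has]; omega
      have hB := boundary_of_halfCube hsm (fun F hF hFs hFF => hC _ m F hsm hF hFs hFF) hD hE hDs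
      -- rewrite the integer sums as counts
      have hdiag : ∑ v ∈ D ∩ E, (if #v + (m + 1) ≤ #(insert a s) then (1 : ℤ) else -1)
          = (#((D ∩ E).filter fun v => #v < m) : ℤ) - #((D ∩ E).filter fun v => m ≤ #v) := by
        rw [natCast_card_filter, natCast_card_filter, ← sum_sub_distrib]
        refine sum_congr rfl fun v _ => ?_
        rw [hsm]; split_ifs <;> omega
      have hcross : ∑ z ∈ D with insert a s \ z ∈ E,
            ((if m + 1 ≤ #z then 1 else 0) + (if #z + (m + 1) ≤ #(insert a s) then 1 else 0) - 1 : ℤ)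
          = - #((D.filter fun z => insert a s \ z ∈ E).filter fun z => #z = m) := by
        rw [natCast_card_filter, ← sum_neg_distrib]
        refine sum_congr rfl fun v _ => ?_
        rw [hsm]; split_ifs <;> omega
      rw [hdiag, hcross]
      have := hB
      omega
    · have hk' : 2 * k ≤ #s + 2 := by omega
      have h1 := ih k (D.memberSubfamily a) (E.memberSubfamily a) hD.memberSubfamily hE.memberSubfamily
        (fun t ht => subset_of_mem_memberSubfamily hDs ht) (fun t ht => subset_of_mem_memberSubfamily hEs ht) hk'
      have h2 := ih (k - 1) (D.nonMemberSubfamily a) (E.nonMemberSubfamily a) hD.nonMemberSubfamily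
        hE.nonMemberSubfamily (fun t ht => subset_of_mem_nonMemberSubfamily hDs ht)
        (fun t ht => subset_of_mem_nonMemberSubfamily hEs ht) (by omega)
      have h3 := psi_section has hD hE hDs k (by omega)
      linarith

/-- **(RAB_k) for every `k`, counting form** (conditional on the half-cube lemma).  For lower sets `D, E ⊆ 𝒫(s)`, `y = #s`,
`2k ≤ y + 2`, and cross pairs `X = {z ∈ D : s \ z ∈ E}`:
`#{z ∈ X : k ≤ #z} + #{z ∈ X : #z + k ≤ y} + #{v ∈ D∩E : y < #v + k} ≤ #X + #{v ∈ D∩E : #v + k ≤ y}`.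
Up-set dictionary (`u = s \ v`): `#{u ∈ A∩B : #u ≥ k} − #{u ∈ A∩B : #u < k} ≥ Σ_{z ∈ A, s\z ∈ B} ([#z ≥ k] + [y − #z ≥ k] − 1)`,
gen-17's (RAB_k). [this work] -/
theorem rab_counting_of_halfCube
    (hC : ∀ (t : Finset α) (m : ℕ) (F : Finset (Finset α)), #t = 2 * m → IsLowerSet (F : Set (Finset α)) →
      (∀ u ∈ F, u ⊆ t) → (∀ z ∈ F, ∀ w ∈ F, z ∪ w ≠ t) → #(F.filter fun z => m ≤ #z) ≤ #(F.filter fun z => #z < m))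
    (s : Finset α) (k : ℕ) (D E : Finset (Finset α)) (hD : IsLowerSet (D : Set (Finset α)))
    (hE : IsLowerSet (E : Set (Finset α))) (hDs : ∀ t ∈ D, t ⊆ s) (hEs : ∀ t ∈ E, t ⊆ s) (hk : 2 * k ≤ #s + 2) :
    #((D.filter fun z => s \ z ∈ E).filter fun z => k ≤ #z)
        + #((D.filter fun z => s \ z ∈ E).filter fun z => #z + k ≤ #s)
        + #((D ∩ E).filter fun v => #s < #v + k)
      ≤ #(D.filter fun z => s \ z ∈ E) + #((D ∩ E).filter fun v => #v + k ≤ #s) := by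
  have h := rab_of_halfCube hC s k D E hD hE hDs hEs hk
  have hdiag : ∑ v ∈ D ∩ E, (if #v + k ≤ #s then (1 : ℤ) else -1)
      = (#((D ∩ E).filter fun v => #v + k ≤ #s) : ℤ) - #((D ∩ E).filter fun v => #s < #v + k) := by
    rw [natCast_card_filter, natCast_card_filter, ← sum_sub_distrib]
    refine sum_congr rfl fun v _ => ?_
    split_ifs <;> omega
  have hcross : ∑ z ∈ D with s \ z ∈ E, ((if k ≤ #z then 1 else 0) + (if #z + k ≤ #s then 1 else 0) - 1 : ℤ)
      = (#((D.filter fun z => s \ z ∈ E).filter fun z => k ≤ #z) : ℤ)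
        + #((D.filter fun z => s \ z ∈ E).filter fun z => #z + k ≤ #s) - #(D.filter fun z => s \ z ∈ E) := by
    rw [natCast_card_filter, natCast_card_filter, card_eq_sum_ones (D.filter fun z => s \ z ∈ E),
      sum_sub_distrib, sum_add_distrib]
    push_cast
    rfl
  rw [hdiag, hcross] at h
  omega

end Summit.CriticalPhenomena.PercolationContinuityZ3.Theorems.ThresholdRAB
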